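import Summits.Ventures.CertifiedManyBodySolver.Downfold.RouterWordScoreAgF2Typing
import Summits.Ventures.CertifiedManyBodySolver.Downfold.RouterScoreHeaderReading

/-!
# The router's R0 STATUS CLASS and what it decides for the §4.2 score: under a typing that expects no structural primary, the truth's
# structure status ALONE chooses between «ABSTAIN(structure)» and the verdict of the physics print (seat hubbard-downfold-score-2 gen 21;
# the M278 WTe₂-Td @15 ruling R-zb of 2026-08-30T07:15Z in kernel form, filed with its receipt)

Venture CertifiedManyBodySolver, cell `pub/hubbard-downfold`; namespace `Summit.Ventures.CertifiedManyBodySolver.Downfold.RouterScore`.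
Everything here is PROVED (no `sorry`, standard axioms).

`router/router.py::_r0_class` reads `structure.status` in THREE classes — routable (established ∣ relaxed ∣ assumed ∣ …), «UND:STRUCT»
(none ∣ unstable ∣ not-converged), «UND:DISPUTED» (disputed ∣ retracted) — and prints the R0 token FIRST when the class is not routable
(run-8 g14 LINE FIRST no. 2, 2026-08-30T07:15:21Z; lead g35 RULING R-zb: the truth's status is SET VERBATIM, D-0100). PROVED here, over the
router's head alphabet: `r0Print` (the print = R0 token, if any, then the physics word); `score_r0Print` — against any registered typing
that expects NO structural primary, the cell scores `ABSTAIN_structure` under a non-routable status WHATEVER the physics word, and the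
physics word's own verdict under a routable one («an abstention the truth's status forces, not a result»); hence `r0_nonroutable_never_decided`
(no AGREE / PARTIAL / DISAGREE is reachable by any physics word under 'disputed' / 'unstable' / …) and `r0_routable_transparent`. The M278
WTe₂-Td @15 R0-STATUS SENSITIVITY replays (box #436: 'disputed' ⇒ «UND:DISPUTED+UND:MIXED+EPH» ABSTAIN · 'unstable' ⇒ ABSTAIN · 'assumed' /
'established' ⇒ «UND:MIXED+EPH» PARTIAL) follow by `decide` (`wte2_p15_replays`), and the material's HEADER-LEVEL reading (lowest-P cell @0 =
PARTIAL) is invariant to the status choice at @15 (`wte2_header_invariant`, `RouterScoreHeaderReading`). Contrast (`h3s_type_status_scored`):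
where the typing DOES expect a structural primary (H₃S-type «EPH ∣ UND:STRUCT ∣ UND:STRUCT+EPH»), the R0 token is scored like any head.

WHAT THIS IS NOT: not a status ruling (R-zb is the desk's; the truth's status is the curators'), not physics, not the scorer of record.
-/

namespace Summit.Ventures.CertifiedManyBodySolver.Downfold

namespace RouterScore

open Head

/-! ## §1 Status classes and the printed word -/

/-- the truth file's `structure.status` values the router reads (router.py `_r0_class`; anything else is routable). [folklore] -/
inductive Status
  | established | relaxed | assumed | none | unstable | notConverged | disputed | retracted | otherStatus
  deriving DecidableEq, Repr

/-- the three R0 classes. [folklore] -/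
inductive R0Class
  | routable | undStruct | undDisputed
  deriving DecidableEq, Repr

/-- router.py `_r0_class` verbatim: none ∣ unstable ∣ not-converged ⇒ «UND:STRUCT»; disputed ∣ retracted ⇒ «UND:DISPUTED»; else routable.
[folklore] -/
def r0Class : Status → R0Class
  | .none | .unstable | .notConverged => .undStruct
  | .disputed | .retracted => .undDisputed
  | _ => .routable

/-- the R0 token printed FIRST for a non-routable class (none for routable). [folklore] -/
def r0Token : R0Class → Option Head
  | .routable => Option.none
  | .undStruct => some undStruct
  | .undDisputed => some undDisputed

/-- the cell's print: the R0 token (if any) FIRST, then the physics word `w` (router.py R0 «printed first»). [folklore] -/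
def r0Print (c : R0Class) (w : List Head) : List Head :=
  match r0Token c with
  | some t => t :: w
  | Option.none => w

/-- every R0 token is a structural head. [folklore] -/
theorem r0Token_structural (c : R0Class) (t : Head) (h : r0Token c = some t) : t.structural = true := by
  cases c <;> simp [r0Token] at h <;> subst h <;> rfl

/-! ## §2 What the status decides -/

/-- THE STATUS DECIDES. Against a registered typing expecting no structural primary: non-routable status ⇒ `ABSTAIN_structure` whatever
the physics word; routable ⇒ the physics word's own verdict. [folklore] -/
theorem score_r0Print (c : R0Class) (w : List Head) (alts : List (List Head)) (halts : alts ≠ [])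
    (hexp : expectsStructural Head.structural alts = false) :
    score (r0Print c w) alts = (if c = .routable then score w alts else .ABSTAIN_structure) := by
  cases c with
  | routable => simp [r0Print, r0Token]
  | undStruct =>
    rw [if_neg (by decide)]
    exact outcome_structural_abstain _ halts (by rfl) hexp
  | undDisputed =>
    rw [if_neg (by decide)]
    exact outcome_structural_abstain _ halts (by rfl) hexp

/-- … so under a non-routable status NO decided verdict (AGREE / PARTIAL / DISAGREE) is reachable by any physics word — «an abstention
the truth's status forces, not a result». [folklore] -/
theorem r0_nonroutable_never_decided (c : R0Class) (hc : c ≠ .routable) (w : List Head) (alts : List (List Head))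
    (halts : alts ≠ []) (hexp : expectsStructural Head.structural alts = false) :
    score (r0Print c w) alts ≠ .AGREE ∧ score (r0Print c w) alts ≠ .PARTIAL ∧ score (r0Print c w) alts ≠ .DISAGREE := by
  rw [score_r0Print c w alts halts hexp, if_neg hc]; decide

/-- … and a routable status is transparent: the cell reads exactly the physics word's verdict. [folklore] -/
theorem r0_routable_transparent (s : Status) (hs : r0Class s = .routable) (w : List Head) (alts : List (List Head)) :
    score (r0Print (r0Class s) w) alts = score w alts := by
  rw [hs]; rfl

/-- the status classes of the eight named values. [folklore] -/
theorem r0Class_table :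
    r0Class .established = .routable ∧ r0Class .relaxed = .routable ∧ r0Class .assumed = .routable ∧
    r0Class .none = .undStruct ∧ r0Class .unstable = .undStruct ∧ r0Class .notConverged = .undStruct ∧
    r0Class .disputed = .undDisputed ∧ r0Class .retracted = .undDisputed := by decide

/-! ## §3 M278 WTe₂-Td @15 (box #436; R-zb OPTION (A): status 'disputed' set verbatim) -/

/-- THE R0-STATUS SENSITIVITY REPLAYS of box #436 by `decide`, physics word «UND:MIXED(r_man straddles θ_c3)+EPH» against STRUCTPAIR
«EPH ∣ EPH+UND:STRUCT» (≡ EPH-ONLY, p754634): 'disputed' ⇒ «UND:DISPUTED+UND:MIXED+EPH» ⇒ ABSTAIN(structure) (the record) · 'unstable' ⇒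
«UND:STRUCT+…» ⇒ ABSTAIN(structure) · 'assumed' / 'established' ⇒ «UND:MIXED+EPH» ⇒ PARTIAL (the @0 class). [folklore] -/
theorem wte2_p15_replays :
    score (r0Print (r0Class .disputed) [undMixed, eph]) structpair = .ABSTAIN_structure ∧
    score (r0Print (r0Class .unstable) [undMixed, eph]) structpair = .ABSTAIN_structure ∧
    score (r0Print (r0Class .assumed) [undMixed, eph]) structpair = .PARTIAL ∧
    score (r0Print (r0Class .established) [undMixed, eph]) structpair = .PARTIAL := by decide

/-- Under STRUCTPAIR no status makes this physics word AGREE: routable ⇒ PARTIAL, non-routable ⇒ ABSTAIN. [folklore] -/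
theorem wte2_p15_never_agree (s : Status) : score (r0Print (r0Class s) [undMixed, eph]) structpair ≠ .AGREE := by
  cases s <;> decide

/-- The material's HEADER-LEVEL reading (MO-PRED annex member = lowest-P worded cell, here @0 = PARTIAL) is INVARIANT to the @15 status
choice: with @0 PARTIAL, M278 reads PARTIAL at header level and is not split whatever the @15 cell scores. [folklore] -/
theorem wte2_header_invariant (o15 : Outcome) :
    headerReading [⟨0, .PARTIAL⟩, ⟨15000, o15⟩] = .PARTIAL ∧ split [⟨0, .PARTIAL⟩, ⟨15000, o15⟩] = false := by
  cases o15 <;> decide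

/-- … while the CELL-LEVEL count does move with it: option (A) leaves one decided cell on M278 (@0 PARTIAL; @15 abstains), option (B)
would have left two (PARTIAL ×2) — decided = AGREE ∣ PARTIAL ∣ DISAGREE. [folklore] -/
def decidedCells (os : List Outcome) : ℕ :=
  (os.filter fun o => decide (o = Outcome.AGREE ∨ o = Outcome.PARTIAL ∨ o = Outcome.DISAGREE)).length

/-- (A) vs (B) on M278's two cells. [folklore] -/
theorem wte2_decided_cells :
    decidedCells [.PARTIAL, .ABSTAIN_structure] = 1 ∧ decidedCells [.PARTIAL, .PARTIAL] = 2 := by decide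

/-! ## §4 Contrast: a typing that EXPECTS a structural primary scores the R0 token like any head -/

/-- the H₃S-type typing «EPH ∣ UND:STRUCT ∣ UND:STRUCT+EPH» (M08 @100-class columns). [folklore] -/
def h3sType : List (List Head) := [[eph], [undStruct], [undStruct, eph]]

/-- Where a structural primary IS expected the status token is scored, not abstained on: 'unstable' + «EPH» ⇒ «UND:STRUCT+EPH» AGREE;
'disputed' + «EPH» ⇒ «UND:DISPUTED+EPH» PARTIAL (EPH rides; DISPUTED is not the typed structural head); routable + «EPH» ⇒ AGREE.
[folklore] -/
theorem h3s_type_status_scored :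
    score (r0Print (r0Class .unstable) [eph]) h3sType = .AGREE ∧
    score (r0Print (r0Class .disputed) [eph]) h3sType = .PARTIAL ∧
    score (r0Print (r0Class .established) [eph]) h3sType = .AGREE := by decide

end RouterScore

end Summit.Ventures.CertifiedManyBodySolver.Downfold
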